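import Literature.Probability.LatticeModels.DartPhase

/-!
# Once-visit chiral arrival phase sums of a medial exploration path (percolation parafermion, `q = 1`)

Topic `Literature/Probability/LatticeModels` (fact-free vocabulary; companion of `DartPhase.lean`).

The exploration path of critical bond percolation on `δℤ²` visits an interior medial vertex `z` (a free
lattice edge) at most twice, and flipping the edge at `z` pairs a configuration visiting `z` ONCE
(arrival winding `W`, turn `t = ±π/2` at `z`) with one visiting it TWICE whose first visit arrives with
the same `W` and turns `-t` and whose second visit is rigid (arrival winding `W + 2t`, turn `-t`;
Smirnov's / Duminil-Copin's one-edge involution; Zhou's once/twice split).  Hence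
every local statistic of the spin-`σ` dart observable `bondDartObservable` at `z` is a linear function
of the joint law of `(t, W)` over ONCE-visits; the two complex numbers
`Z_L(z) = E[1{z visited exactly once, turning left} e^{-iσW}]`, `Z_R(z)` (right) carry it, and at
`σ = 1/3` the KIRCHHOFF DEFECT (incoming minus outgoing dart observables at `z`) equals
`κ_L Z_L + κ_R Z_R` with `κ_L = 2 + λ² − 2λ − λ⁻¹ = (1 − √3)(1 − λ)`, `κ_R = conj κ_L`, `λ = e^{-iπ/6}`
— the chirality-resolved form of eq. (102) of W. Zhou, *SLE₆ and 2-d critical bond percolation on the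
square lattice*, arXiv:2409.03235 (2024), §4 (`√3 K⁽¹⁾ + K⁽²⁾ = 0` for the once/twice parts of the
defect); the identity itself is proved in
`Summits/CriticalPhenomena/CardyFormulaZ2/Theorems/CardySusyWardWeakHolomorphyKirchhoffIdentity.lean`.
Background: H. Duminil-Copin, S. Smirnov, *Conformal invariance of lattice models*, arXiv:1109.1549,
§8.3 (the parafermionic observable, Prop. 8.6, Conj. 8.7); H. Duminil-Copin, arXiv:1208.3787, Def. 3
(winding = total signed rotation), Prop. 4.

## Contents (namespace `Literature.Probability.LatticeModels`)

* `passagePositions γ z` — the interior positions `0 < k < γ.length - 1` of the medial path `γ` at `z`;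
* `turnAt γ δ k` — the signed turning angle of `γ` (read at mesh `δ`) at position `k` (difference of
  the `Polyline.winding`s of the prefixes ending with the leaving and with the arriving dart);
* `onceChiralPhase γ δ σ z left` — `exp(-iσ W_arrival)` if `γ` has exactly one interior passage
  through `z` and turns left there (`left = true`; resp. does not turn left), else `0`;
* `onceChiralObs E δ σ z left = ∫ onceChiralPhase (medialExploration E ω) δ σ z left dP_{1/2}` —
  `Z_L`, `Z_R` for arbitrary discrete Dobrushin data `E`, same measure and path as `bondDartObservable`;
* `onceKappa left` — the constants `κ_L`, `κ_R` above (spin `1/3`);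
* `onceChiralPhase_eq_zero_of_passagePositions_eq_empty` (definitional sanity).
Deliberately NOT here: the identity (it needs the cut-orbit machinery of the `CardyFormulaZ2` theorems),
any asymptotic statement (the "chirality law" `Z_L ≈ e^{iπ/6} Z_R`, equivalent to asymptotic Kirchhoff,
is OPEN), and the bisector-convention vertex observable (see `MedialWinding`).
-/

noncomputable section

namespace Literature.Probability.LatticeModels

open MeasureTheory
open scoped BigOperators

/-- The INTERIOR PASSAGE POSITIONS of the medial path `γ` at the medial vertex `z`: the indices
`0 < k < γ.length - 1` with `γ[k] = z` (position `0` and the last position of an exploration path are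
its two `A`–`B` edges and carry no turn). An exploration path has at most two of them at any `z`.
[cite: DuminilCopinSmirnov2012Lattice, §8.3.1] -/
def passagePositions (γ : List MedialVertex) (z : MedialVertex) : Finset ℕ :=
  (Finset.range γ.length).filter (fun k => 0 < k ∧ k + 1 < γ.length ∧ γ[k]? = some z)

/-- The signed TURNING ANGLE of the medial path `γ` (read at mesh `δ`) at the position `k`: the
winding of the polyline prefix ending with the dart leaving `γ[k]` minus that of the prefix ending
with the dart arriving at `γ[k]` (`+π/2` for a left = counter-clockwise turn, `-π/2` for a right turn
along an exploration path). [cite: DuminilCopin2012Parafermion, Definition 3] -/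
def turnAt (γ : List MedialVertex) (δ : ℝ) (k : ℕ) : ℝ :=
  Polyline.winding ((γ.map (medialPoint δ)).take (k + 2)) - Polyline.winding ((γ.map (medialPoint δ)).take (k + 1))

open Classical in
/-- The ONCE-VISIT CHIRAL ARRIVAL PHASE of the medial path `γ` (mesh `δ`, spin `σ`) at the medial
vertex `z`, chirality `left`: if `γ` has exactly one interior passage through `z`, at position `k`,
and turns left there (`0 < turnAt γ δ k`) when `left = true`, resp. does not turn left when
`left = false`, then the spin-`σ` phase `exp(-iσW)` of the ARRIVAL winding
`W = winding ((γ.map (medialPoint δ)).take (k + 1))` (the prefix ending with the dart into `z`, the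
convention of `dartPhaseSum` for that dart); otherwise `0`. (The once/twice split of Zhou 2024,
eq. (102), resolved by chirality.) [cite: Zhou2024SLE6BondZ2, eq. (102)] -/
def onceChiralPhase (γ : List MedialVertex) (δ σ : ℝ) (z : MedialVertex) (left : Bool) : ℂ :=
  ∑ k ∈ passagePositions γ z,
    if (passagePositions γ z).card = 1 ∧ (0 < turnAt γ δ k ↔ left = true) then
      Complex.exp (-Complex.I * σ * ((Polyline.winding ((γ.map (medialPoint δ)).take (k + 1)) : ℝ) : ℂ))
    else 0

/-- The ONCE-VISIT CHIRAL OBSERVABLE `Z_t(z)` of the discrete Dobrushin data `E` (mesh `δ`, spin `σ`,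
chirality `left`): the `P_{1/2}`-expectation of `onceChiralPhase` of the medial exploration path —
`E[1{z visited exactly once, turning left (resp. right)} · exp(-iσ W_arrival)]`, same path and measure
as `bondDartObservable`. [cite: Zhou2024SLE6BondZ2, eq. (102)] -/
def onceChiralObs (E : DiscreteDobrushin) (δ σ : ℝ) (z : MedialVertex) (left : Bool) : ℂ :=
  ∫ ω, onceChiralPhase (medialExploration E ω) δ σ z left ∂(Percolation.bondPercolation (zdGraph 2) Percolation.half)

/-- The two constants of the Kirchhoff-defect identity at spin `1/3`: with `λ = exp(-iπ/6)` (the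
phase of one left quarter turn), `κ_L = 2 + λ² − 2λ − λ⁻¹` (`left = true`) and
`κ_R = 2 + λ⁻² − 2λ⁻¹ − λ` (`left = false`); `κ_R = conj κ_L = −κ_L·λ⁻¹`, `|κ| = 0.3789…`,
`κ_L = (1 − √3)(1 − λ)`: the Kirchhoff defects `P_in − P_out` summed over the pair {once-visit turning
left (resp. right), its flip} per unit arrival phase. [cite: Zhou2024SLE6BondZ2, eq. (102)] -/
def onceKappa (left : Bool) : ℂ :=
  if left then
    2 + Complex.exp (-(Real.pi / 6 : ℝ) * Complex.I) ^ 2 - 2 * Complex.exp (-(Real.pi / 6 : ℝ) * Complex.I) -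
      Complex.exp ((Real.pi / 6 : ℝ) * Complex.I)
  else
    2 + Complex.exp ((Real.pi / 6 : ℝ) * Complex.I) ^ 2 - 2 * Complex.exp ((Real.pi / 6 : ℝ) * Complex.I) -
      Complex.exp (-(Real.pi / 6 : ℝ) * Complex.I)

/-- Definitional sanity: a path with no interior passage through `z` has vanishing once-visit chiral
phase there. [folklore] -/
theorem onceChiralPhase_eq_zero_of_passagePositions_eq_empty (γ : List MedialVertex) (δ σ : ℝ)
    (z : MedialVertex) (left : Bool) (h : passagePositions γ z = ∅) : onceChiralPhase γ δ σ z left = 0 := by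
  simp [onceChiralPhase, h]

/-- The once-visit chiral phase is bounded by the number of interior passage positions (each term is
`0` or a unimodular phase). [folklore] -/
theorem norm_onceChiralPhase_le (γ : List MedialVertex) (δ σ : ℝ) (z : MedialVertex) (left : Bool) :
    ‖onceChiralPhase γ δ σ z left‖ ≤ (passagePositions γ z).card := by
  unfold onceChiralPhase
  refine (norm_sum_le _ _).trans ?_
  have : ∀ k ∈ passagePositions γ z, ‖(if (passagePositions γ z).card = 1 ∧ (0 < turnAt γ δ k ↔ left = true) then
      Complex.exp (-Complex.I * σ * ((Polyline.winding ((γ.map (medialPoint δ)).take (k + 1)) : ℝ) : ℂ))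
      else 0)‖ ≤ 1 := by
    intro k _
    split_ifs
    · rw [show -Complex.I * (σ : ℂ) * ((Polyline.winding ((γ.map (medialPoint δ)).take (k + 1)) : ℝ) : ℂ) =
          ((-(σ * Polyline.winding ((γ.map (medialPoint δ)).take (k + 1))) : ℝ) : ℂ) * Complex.I by
        push_cast; ring, Complex.norm_exp_ofReal_mul_I]
    · simp
  calc ∑ k ∈ passagePositions γ z, _ ≤ ∑ k ∈ passagePositions γ z, (1 : ℝ) := Finset.sum_le_sum this
    _ = (passagePositions γ z).card := by simp

end Literature.Probability.LatticeModels

end
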